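import Summits.CriticalPhenomena.PercolationContinuityZ3.Theorems.PercNearOneGluingNoHeavyLowerTailSahiCombTriWAndClawPlus

/-!
# AND with the block `clawPath p q r = claw 5 ∪ {⊤∖{p,q}, ⊤∖{p,r}}` (two extra elements under OVERLAPPING pairs of prongs)

Support file of the one-cut programme (crux `NoHeavyLowerTail`, stmt-CriticalPhenomena-4575; unit `prim-lf-1` gen 53), continuation of
`…SahiCombTriWAndClaw` / `…SahiCombTriWAndClawPlus` / `…SahiCombTriWAndClawPlusTwo`.

`clawPlusTwo` (two DISJOINT pairs doubled, the block `cocover5`) was the last member of the family `claw k ∪ {⊤ ∖ e : e ∈ Γ}` (`Γ` a set of pairs of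
prongs) covered so far: `Γ` a matching.  Here `Γ = {{p,q},{p,r}}` is a PATH (the two pairs share the prong `p`); for `k = 5` and `(p,q,r) = (0,1,2)`
this is the block `{234, 134} ∪ {4-sets} ∪ {⊤} = x₃x₄(x₁ ∨ x₂) ∨ (≥ 4 of 5)` (hex `fc808000`; an intersecting Kleitman shell by itself, whereas the
`k = 4` path `claw 4 ∪ {02, 03}` is NOT — its `Cor` reaches `−1` — and the `k = 4` triangle is `perfect4`, still open).
* `clawPath`, `mem_clawPath`, `sum_clawPath`, `isUpperSet_clawPath`, `disjoint_clawPath_refl` (`k ≥ 5`); the two extra columns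
  `v₁ = clawV A p q`, `v₂ = clawV A p r` and their minimum / maximum `clawPmin / clawPmax` with the K-facts `clawPmin/clawPmax_add_clawS_pair`
  (`j ≥ 2`), `clawPmax_le_clawS` (`max ≤ s_{k-2}`) and **`clawPmin_le_clawS`**: the minimum lies below the THREE co-atom columns `p, q, r`, hence
  below `s_{k-3}` (for disjoint pairs it lies below `s_{k-4}`; the two extra columns are NOT paired with each other here).
* **`corP_andProd_clawPath_nonneg`** (`k = 5`): `Cor_{P₁ ∧ clawPath p q r}(A,B) ≥ 0` for every antipode-free up-set `P₁` with `Cor_{P₁} ≥ 0` and all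
  up-sets `A, B`; `triW_nonneg_andProd_clawPath`, `klShell_…`, `lForm_le_scoreVal_andProd_clawPath`.  Certificate (exact LP over the symbol cone,
  `k = 5`; `clawPath_cert_identity`):
  `2(uu' + s₀s₄' + s₁s₃' + s₂s₂' + s₃s₁' + s₄s₀' + mM' + Mm') = [u(s₀'+s₁') + (s₀+s₁)u'] + [s₄(s₀'+s₁') + (s₀+s₁)s₄'] + [(m+s₂)(M'+s₃') + (M+s₃)(m'+s₂')] + NN`
  (`m ≤ M` the sorted extra columns, `m ≤ s₂`, `M ≤ s₃`); it uses neither a pairing of the two extra columns nor `m ≤ s₁`, so the same identity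
  also certifies `clawPlusTwo` at `k = 5`.
HONEST LABEL: complete proofs, std axioms; ONE more block (`k = 5`, extras under two overlapping pairs) of the conjecture "`P₁ ∧ Q` is an
intersecting Kleitman shell for every pair of intersecting Kleitman shells"; `k ≥ 6`, the triangle (`perfect4` at `k = 4`) and the general
conjecture stay OPEN. [this work]
-/


namespace Summit.CriticalPhenomena.PercolationContinuityZ3.Theorems

namespace FiveUpSet

open Finset

variable {γ₁ : Type} [DecidableEq γ₁] [Fintype γ₁] {k : ℕ}

/-! ### The family -/

/-- `clawPath p q r = clawPlus p q ∪ {univ ∖ {p,r}}`: the claw with the two extra elements `⊤∖{p,q}`, `⊤∖{p,r}`. [this work] -/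
def clawPath (p q r : Fin k) : Finset (Finset (Fin k)) := insert ((univ.erase p).erase r) (clawPlus p q)

/-- Membership in `clawPath`. [this work] -/
theorem mem_clawPath {p q r : Fin k} {y : Finset (Fin k)} :
    y ∈ clawPath p q r ↔ y = (univ.erase p).erase r ∨ (y = (univ.erase p).erase q ∨ k ≤ y.card + 1) := by
  unfold clawPath; rw [mem_insert, mem_clawPlus]

/-- The second extra element is not in `clawPlus p q`. [this work] -/
theorem erase_erase_notMem_clawPlus_path {p q r : Fin k} (h : p ≠ q ∧ p ≠ r ∧ q ≠ r) : (univ.erase p).erase r ∉ clawPlus p q := by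
  rw [mem_clawPlus, not_or]
  refine ⟨fun he => ?_, fun hc => erase_erase_notMem_claw h.2.1 (mem_claw.2 hc)⟩
  have : q ∈ (univ.erase p).erase r := mem_erase.2 ⟨h.2.2, mem_erase.2 ⟨fun e => h.1 e.symm, mem_univ _⟩⟩
  rw [he] at this
  exact (mem_erase.1 this).1 rfl

/-- Summing over `clawPath`. [this work] -/
theorem sum_clawPath {p q r : Fin k} (h : p ≠ q ∧ p ≠ r ∧ q ≠ r) (f : Finset (Fin k) → ℤ) :
    ∑ y ∈ clawPath p q r, f y = f ((univ.erase p).erase r) + ∑ y ∈ clawPlus p q, f y := by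
  unfold clawPath; rw [sum_insert (erase_erase_notMem_clawPlus_path h)]

/-- `clawPath` is an up-set. [this work] -/
theorem isUpperSet_clawPath {p q r : Fin k} (h : p ≠ q ∧ p ≠ r ∧ q ≠ r) :
    IsUpperSet (clawPath p q r : Set (Finset (Fin k))) := by
  intro y y' hyy' hy
  rw [mem_coe, mem_clawPath] at hy ⊢
  rcases hy with rfl | hy
  · by_cases he : y' = (univ.erase p).erase r
    · exact Or.inl he
    · right; right
      have hlt : ((univ.erase p).erase r).card < y'.card := card_lt_card (lt_of_le_of_ne hyy' (fun h' => he h'.symm))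
      rw [card_erase_erase h.2.1] at hlt
      omega
  · exact Or.inr (mem_clawPlus.1 (mem_coe.1 ((isUpperSet_clawPlus h.1) hyy' (mem_coe.2 (mem_clawPlus.2 hy)))))

/-- `clawPath` is antipode free for `k ≥ 5`. [this work] -/
theorem disjoint_clawPath_refl (hk : 5 ≤ k) {p q r : Fin k} (h : p ≠ q ∧ p ≠ r ∧ q ≠ r) :
    Disjoint (clawPath p q r) (refl (clawPath p q r)) := by
  rw [disjoint_left]
  intro y hy hy'
  rw [mem_refl, mem_clawPath] at hy'
  rw [mem_clawPath] at hy
  have hc := card_compl y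
  rw [Fintype.card_fin] at hc
  have hcy := card_le_univ y
  rw [Fintype.card_fin] at hcy
  have hce₁ := card_erase_erase h.1
  have hce₂ := card_erase_erase h.2.1
  have size : ∀ z : Finset (Fin k), (z = (univ.erase p).erase r ∨ (z = (univ.erase p).erase q ∨ k ≤ z.card + 1)) → k ≤ z.card + 2 := by
    rintro z (rfl | rfl | hz)
    · rw [hce₂]; omega
    · rw [hce₁]; omega
    · omega
  have h1 := size y hy
  have h2 := size yᶜ hy'
  omega

/-! ### The two extra columns `v₁ = clawV A p q`, `v₂ = clawV A p r`: minimum and maximum -/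

/-- Minimum of the two extra columns. [this work] -/
def clawPmin (A : Finset (Finset (γ₁ ⊕ Fin k))) (p q r : Fin k) (x : Finset γ₁) : ℤ := min (clawV A p q x) (clawV A p r x)

/-- Maximum of the two extra columns. [this work] -/
def clawPmax (A : Finset (Finset (γ₁ ⊕ Fin k))) (p q r : Fin k) (x : Finset γ₁) : ℤ := max (clawV A p q x) (clawV A p r x)

section minmaxfacts
variable {A : Finset (Finset (γ₁ ⊕ Fin k))} (hA : IsUpperSet (A : Set (Finset (γ₁ ⊕ Fin k)))) {p q r : Fin k}
include hA

omit hA in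
/-- Bounds of the minimum. [this work] -/
theorem clawPmin_bounds (x : Finset γ₁) : -1 ≤ clawPmin A p q r x ∧ clawPmin A p q r x ≤ 1 := by
  unfold clawPmin; have := clawV_bounds A p q x; have := clawV_bounds A p r x; simp only [min_def]; split_ifs <;> omega

omit hA in
/-- Bounds of the maximum. [this work] -/
theorem clawPmax_bounds (x : Finset γ₁) : -1 ≤ clawPmax A p q r x ∧ clawPmax A p q r x ≤ 1 := by
  unfold clawPmax; have := clawV_bounds A p q x; have := clawV_bounds A p r x; simp only [max_def]; split_ifs <;> omega

/-- The minimum is increasing. [this work] -/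
theorem clawPmin_mono {x x' : Finset γ₁} (h : x ⊆ x') : clawPmin A p q r x ≤ clawPmin A p q r x' := by
  unfold clawPmin; exact min_le_min (clawV_mono hA h) (clawV_mono hA h)

/-- The maximum is increasing. [this work] -/
theorem clawPmax_mono {x x' : Finset γ₁} (h : x ⊆ x') : clawPmax A p q r x ≤ clawPmax A p q r x' := by
  unfold clawPmax; exact max_le_max (clawV_mono hA h) (clawV_mono hA h)

/-- Pair condition of the two-layer vector `min + s_j` (`j ≥ 2`). [this work] -/
theorem clawPmin_add_clawS_pair {x x' : Finset γ₁} (h : x ∪ x' = univ) (j : Fin k) (hj : 2 ≤ (j : ℕ)) :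
    0 ≤ (clawPmin A p q r x + clawS A x j) + (clawPmin A p q r x' + clawS A x' j) := by
  unfold clawPmin
  have h1 := clawV_add_clawS_nonneg hA (p := p) (q := q) h j hj
  have h2 := clawV_add_clawS_nonneg hA (p := p) (q := r) h j hj
  have h3 := clawV_add_clawS_nonneg hA (p := p) (q := q) (by rw [union_comm]; exact h) j hj
  have h4 := clawV_add_clawS_nonneg hA (p := p) (q := r) (by rw [union_comm]; exact h) j hj
  simp only [min_def]; split_ifs <;> linarith

/-- Pair condition of the two-layer vector `max + s_j` (`j ≥ 2`). [this work] -/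
theorem clawPmax_add_clawS_pair {x x' : Finset γ₁} (h : x ∪ x' = univ) (j : Fin k) (hj : 2 ≤ (j : ℕ)) :
    0 ≤ (clawPmax A p q r x + clawS A x j) + (clawPmax A p q r x' + clawS A x' j) := by
  unfold clawPmax
  have h1 := clawV_add_clawS_nonneg hA (p := p) (q := q) h j hj
  have h2 := clawV_add_clawS_nonneg hA (p := p) (q := r) h j hj
  have h3 := clawV_add_clawS_nonneg hA (p := p) (q := q) (by rw [union_comm]; exact h) j hj
  have h4 := clawV_add_clawS_nonneg hA (p := p) (q := r) (by rw [union_comm]; exact h) j hj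
  simp only [max_def]; split_ifs <;> linarith

/-- The maximum is dominated by the second-largest sorted column. [this work] -/
theorem clawPmax_le_clawS (hpq : p ≠ q ∧ p ≠ r ∧ q ≠ r) (x : Finset γ₁) (jc : Fin k) (hjc : (jc : ℕ) = k - 2) :
    clawPmax A p q r x ≤ clawS A x jc := by
  unfold clawPmax
  exact max_le (clawV_le_clawS hA hpq.1 x jc hjc) (clawV_le_clawS hA hpq.2.1 x jc hjc)

/-- **The minimum is dominated by the third-largest sorted column** (it lies below the three co-atom columns `p, q, r`). [this work] -/
theorem clawPmin_le_clawS (hpq : p ≠ q ∧ p ≠ r ∧ q ≠ r) (x : Finset γ₁) (je : Fin k) (hje : (je : ℕ) = k - 3) :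
    clawPmin A p q r x ≤ clawS A x je := by
  by_contra hlt
  have hle : clawS A x je ≤ clawPmin A p q r x - 1 := by omega
  rw [clawS_le_iff] at hle
  have m1 := clawV_le_clawW_left hA (p := p) (q := q) x
  have m2 := clawV_le_clawW_right hA (p := p) (q := q) x
  have m3 := clawV_le_clawW_right hA (p := p) (q := r) x
  have hmin1 : clawPmin A p q r x ≤ clawV A p q x := min_le_left _ _
  have hmin2 : clawPmin A p q r x ≤ clawV A p r x := min_le_right _ _
  -- the columns `≤ min - 1` avoid the three indices
  have hsub : (univ.filter fun i => clawW A i x ≤ clawPmin A p q r x - 1) ⊆ ((univ.erase p).erase q).erase r := by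
    intro i hi
    rw [mem_filter] at hi
    refine mem_erase.2 ⟨fun e => ?_, mem_erase.2 ⟨fun e => ?_, mem_erase.2 ⟨fun e => ?_, mem_univ i⟩⟩⟩ <;>
      rw [e] at hi <;> omega
  have hcard : (((univ.erase p).erase q).erase r).card = k - 3 := by
    have e3 : r ∈ (univ.erase p).erase q := mem_erase.2 ⟨fun e => hpq.2.2 e.symm, mem_erase.2 ⟨fun e => hpq.2.1 e.symm, mem_univ _⟩⟩
    rw [card_erase_of_mem e3, card_erase_erase hpq.1]
    omega
  have := card_le_card hsub
  rw [hcard] at this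
  omega

end minmaxfacts

/-! ### The row decomposition and the theorem (`k = 5`) -/

/-- Row decomposition, first step: split off the second extra column. [this work] -/
theorem corP_andProd_clawPath_eq' {p q r : Fin k} (h : p ≠ q ∧ p ≠ r ∧ q ≠ r)
    (P₁ : Finset (Finset γ₁)) (A B : Finset (Finset (γ₁ ⊕ Fin k))) :
    corP (andProd P₁ (clawPath p q r)) A B = (∑ x ∈ P₁, clawV A p r x * clawV B p r x) + corP (andProd P₁ (clawPlus p q)) A B := by
  rw [corP_eq_sum, corP_eq_sum, andProd_eq_biUnion, sum_biUnion (pairwiseDisjoint_rows P₁ _), andProd_eq_biUnion,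
    sum_biUnion (pairwiseDisjoint_rows P₁ _), ← sum_add_distrib]
  refine sum_congr rfl fun x _ => ?_
  rw [sum_map, sum_map, sum_clawPath h]
  unfold clawV
  simp only [rowEmb_apply]

/-- **Row decomposition**: `Cor_{P₁ ∧ clawPath}(A,B) = Σ_{x∈P₁} [v₁v₁' + v₂v₂'] + Cor_{P₁ ∧ claw k}(A,B)`. [this work] -/
theorem corP_andProd_clawPath_eq {p q r : Fin k} (h : p ≠ q ∧ p ≠ r ∧ q ≠ r)
    (P₁ : Finset (Finset γ₁)) (A B : Finset (Finset (γ₁ ⊕ Fin k))) :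
    corP (andProd P₁ (clawPath p q r)) A B
      = (∑ x ∈ P₁, (clawV A p q x * clawV B p q x + clawV A p r x * clawV B p r x)) + corP (andProd P₁ (claw k)) A B := by
  rw [corP_andProd_clawPath_eq' h, corP_andProd_clawPlus_eq h.1, ← add_assoc, ← sum_add_distrib]
  congr 1
  exact sum_congr rfl fun x _ => by ring

/-- The polynomial identity behind the `k = 5` certificate (it uses only `m ≤ s₂`, `M ≤ s₃` and the K-facts of `m + s₂`, `M + s₃`). [this work] -/
theorem clawPath_cert_identity (u s0 s1 s2 s3 s4 m M u' s0' s1' s2' s3' s4' m' M' : ℤ) :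
    2 * (u * u' + s0 * s4' + s1 * s3' + s2 * s2' + s3 * s1' + s4 * s0' + m * M' + M * m')
      = (u * (s0' + s1') + (s0 + s1) * u' + s4 * (s0' + s1') + (s0 + s1) * s4' + (m + s2) * (M' + s3') + (M + s3) * (m' + s2'))
        + ((s1 - s0) * (u' - s4') + (u - s4) * (s1' - s0') + 2 * ((s2 - s1) * (s4' - s3') + (s4 - s3) * (s2' - s1'))
          + 2 * ((s2 - s1) * (u' - s4') + (u - s4) * (s2' - s1'))
          + 2 * ((s3 - s2) * (s3' - s2')) + 2 * ((s3 - s2) * (s4' - s3') + (s4 - s3) * (s3' - s2'))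
          + 2 * ((s3 - s2) * (u' - s4') + (u - s4) * (s3' - s2')) + 2 * ((s4 - s3) * (s4' - s3'))
          + 2 * ((s4 - s3) * (u' - s4') + (u - s4) * (s4' - s3')) + 2 * ((u - s4) * (u' - s4'))
          + ((s3 - M) * (s2' - m') + (s2 - m) * (s3' - M'))) := by
  ring

section mainthm
variable {P₁ : Finset (Finset γ₁)} (hP : IsUpperSet (P₁ : Set (Finset γ₁))) (hd : Disjoint P₁ (refl P₁))
  (hcor : ∀ U V : Finset (Finset γ₁), IsUpperSet (U : Set (Finset γ₁)) → IsUpperSet (V : Set (Finset γ₁)) → 0 ≤ corP P₁ U V)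
  {A B : Finset (Finset (γ₁ ⊕ Fin 5))} (hA : IsUpperSet (A : Set (Finset (γ₁ ⊕ Fin 5)))) (hB : IsUpperSet (B : Set (Finset (γ₁ ⊕ Fin 5))))

include hP hd hcor hA hB in
/-- **THEOREM (AND with a claw-path block, `k = 5`).**  If `P₁` is an antipode-free up-set with `Cor_{P₁} ≥ 0` on all pairs of up-sets and
`p q r : Fin 5` are pairwise distinct, then `Cor_{P₁ ∧ clawPath p q r}(A,B) ≥ 0` for all up-sets `A, B` of `2^{γ₁ ⊕ Fin 5}`. [this work] -/
theorem corP_andProd_clawPath_nonneg {p q r : Fin 5} (hpq : p ≠ q ∧ p ≠ r ∧ q ≠ r) :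
    0 ≤ corP (andProd P₁ (clawPath p q r)) A B := by
  rw [corP_andProd_clawPath_eq hpq, corP_andProd_claw_eq]
  have r0 : Fin.rev (0 : Fin 5) = 4 := by decide
  have r1 : Fin.rev (1 : Fin 5) = 3 := by decide
  have r2 : Fin.rev (2 : Fin 5) = 2 := by decide
  have r3 : Fin.rev (3 : Fin 5) = 1 := by decide
  have r4 : Fin.rev (4 : Fin 5) = 0 := by decide
  -- (1) pointwise: rearrangements
  have step1 : ∀ x ∈ P₁,
      (clawU A x * clawU B x + clawS A x 0 * clawS B x 4 + clawS A x 1 * clawS B x 3 + clawS A x 2 * clawS B x 2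
        + clawS A x 3 * clawS B x 1 + clawS A x 4 * clawS B x 0
        + clawPmin A p q r x * clawPmax B p q r x + clawPmax A p q r x * clawPmin B p q r x)
      ≤ (clawV A p q x * clawV B p q x + clawV A p r x * clawV B p r x)
        + (clawU A x * clawU B x + ∑ i : Fin 5, clawW A i x * clawW B i x) := by
    intro x _
    have hr := rearr_clawS A B x
    rw [Fin.sum_univ_five, r0, r1, r2, r3, r4] at hr
    have hv := rearr_two (clawV A p q x) (clawV A p r x) (clawV B p q x) (clawV B p r x)
    unfold clawPmin clawPmax
    linarith
  -- (2) pointwise: certificate, NN ≥ 0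
  have step2 : ∀ x ∈ P₁,
      (clawU A x * (clawS B x 0 + clawS B x 1) + (clawS A x 0 + clawS A x 1) * clawU B x
        + clawS A x 4 * (clawS B x 0 + clawS B x 1) + (clawS A x 0 + clawS A x 1) * clawS B x 4
        + (clawPmin A p q r x + clawS A x 2) * (clawPmax B p q r x + clawS B x 3)
        + (clawPmax A p q r x + clawS A x 3) * (clawPmin B p q r x + clawS B x 2))
      ≤ 2 * (clawU A x * clawU B x + clawS A x 0 * clawS B x 4 + clawS A x 1 * clawS B x 3 + clawS A x 2 * clawS B x 2
        + clawS A x 3 * clawS B x 1 + clawS A x 4 * clawS B x 0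
        + clawPmin A p q r x * clawPmax B p q r x + clawPmax A p q r x * clawPmin B p q r x) := by
    intro x _
    have hid := clawPath_cert_identity (clawU A x) (clawS A x 0) (clawS A x 1) (clawS A x 2) (clawS A x 3) (clawS A x 4)
      (clawPmin A p q r x) (clawPmax A p q r x)
      (clawU B x) (clawS B x 0) (clawS B x 1) (clawS B x 2) (clawS B x 3) (clawS B x 4) (clawPmin B p q r x) (clawPmax B p q r x)
    have a10 : 0 ≤ clawS A x 1 - clawS A x 0 := sub_nonneg.2 (clawS_monotone A x (by decide))
    have a21 : 0 ≤ clawS A x 2 - clawS A x 1 := sub_nonneg.2 (clawS_monotone A x (by decide))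
    have a32 : 0 ≤ clawS A x 3 - clawS A x 2 := sub_nonneg.2 (clawS_monotone A x (by decide))
    have a43 : 0 ≤ clawS A x 4 - clawS A x 3 := sub_nonneg.2 (clawS_monotone A x (by decide))
    have au4 : 0 ≤ clawU A x - clawS A x 4 := sub_nonneg.2 (clawS_le_clawU hA x 4)
    have a3M : 0 ≤ clawS A x 3 - clawPmax A p q r x := sub_nonneg.2 (clawPmax_le_clawS hA hpq x 3 rfl)
    have a2m : 0 ≤ clawS A x 2 - clawPmin A p q r x := sub_nonneg.2 (clawPmin_le_clawS hA hpq x 2 rfl)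
    have b10 : 0 ≤ clawS B x 1 - clawS B x 0 := sub_nonneg.2 (clawS_monotone B x (by decide))
    have b21 : 0 ≤ clawS B x 2 - clawS B x 1 := sub_nonneg.2 (clawS_monotone B x (by decide))
    have b32 : 0 ≤ clawS B x 3 - clawS B x 2 := sub_nonneg.2 (clawS_monotone B x (by decide))
    have b43 : 0 ≤ clawS B x 4 - clawS B x 3 := sub_nonneg.2 (clawS_monotone B x (by decide))
    have bu4 : 0 ≤ clawU B x - clawS B x 4 := sub_nonneg.2 (clawS_le_clawU hB x 4)
    have b3M : 0 ≤ clawS B x 3 - clawPmax B p q r x := sub_nonneg.2 (clawPmax_le_clawS hB hpq x 3 rfl)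
    have b2m : 0 ≤ clawS B x 2 - clawPmin B p q r x := sub_nonneg.2 (clawPmin_le_clawS hB hpq x 2 rfl)
    have n1 := mul_nonneg a10 bu4; have n2 := mul_nonneg au4 b10; have n3 := mul_nonneg a21 b43; have n4 := mul_nonneg a43 b21
    have n5 := mul_nonneg a21 bu4; have n6 := mul_nonneg au4 b21
    have n9 := mul_nonneg a32 b32; have n10 := mul_nonneg a32 b43; have n11 := mul_nonneg a43 b32; have n12 := mul_nonneg a32 bu4
    have n13 := mul_nonneg au4 b32; have n14 := mul_nonneg a43 b43; have n15 := mul_nonneg a43 bu4; have n16 := mul_nonneg au4 b43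
    have n17 := mul_nonneg au4 bu4; have n18 := mul_nonneg a3M b2m; have n19 := mul_nonneg a2m b3M
    linarith
  -- (3) acuteness of the six K ⊗ K sums
  have bS2 : ∀ (C : Finset (Finset (γ₁ ⊕ Fin 5))) (i j : Fin 5), ∀ x ∈ P₁, -2 ≤ clawS C x i + clawS C x j ∧ clawS C x i + clawS C x j ≤ 2 :=
    fun C i j x _ => by have := clawS_bounds C x i; have := clawS_bounds C x j; constructor <;> linarith
  have bS1 : ∀ (C : Finset (Finset (γ₁ ⊕ Fin 5))) (j : Fin 5), ∀ x ∈ P₁, -2 ≤ clawS C x j ∧ clawS C x j ≤ 2 :=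
    fun C j x _ => by have := clawS_bounds C x j; constructor <;> linarith
  have bU : ∀ (C : Finset (Finset (γ₁ ⊕ Fin 5))), ∀ x ∈ P₁, -2 ≤ clawU C x ∧ clawU C x ≤ 2 :=
    fun C x _ => by have := clawU_bounds (A := C) x; constructor <;> linarith
  have bmS : ∀ (C : Finset (Finset (γ₁ ⊕ Fin 5))) (j : Fin 5), ∀ x ∈ P₁,
      -2 ≤ clawPmin C p q r x + clawS C x j ∧ clawPmin C p q r x + clawS C x j ≤ 2 :=
    fun C j x _ => by have := clawPmin_bounds (A := C) (p := p) (q := q) (r := r) x; have := clawS_bounds C x j; constructor <;> linarith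
  have bMS : ∀ (C : Finset (Finset (γ₁ ⊕ Fin 5))) (j : Fin 5), ∀ x ∈ P₁,
      -2 ≤ clawPmax C p q r x + clawS C x j ∧ clawPmax C p q r x + clawS C x j ≤ 2 :=
    fun C j x _ => by have := clawPmax_bounds (A := C) (p := p) (q := q) (r := r) x; have := clawS_bounds C x j; constructor <;> linarith
  have h1 : (1 : ℕ) ≤ ((1 : Fin 5) : ℕ) := by decide
  have h4 : (1 : ℕ) ≤ ((4 : Fin 5) : ℕ) := by decide
  have h2' : (2 : ℕ) ≤ ((2 : Fin 5) : ℕ) := by decide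
  have h3' : (2 : ℕ) ≤ ((3 : Fin 5) : ℕ) := by decide
  have t1 := sum_mul_nonneg_of_two hP hd hcor (fun x => clawU A x) (fun x => clawS B x 0 + clawS B x 1) (bU A) (bS2 B 0 1)
    (fun x _ x' _ h => clawU_mono hA h) (fun x _ x' _ h => add_le_add (clawS_mono hB h 0) (clawS_mono hB h 1))
    (fun x _ x' _ h => clawU_add_clawU_nonneg hA h) (fun x _ x' _ h => clawS_add_pair hB h 0 1 h1)
  have t2 := sum_mul_nonneg_of_two hP hd hcor (fun x => clawS A x 0 + clawS A x 1) (fun x => clawU B x) (bS2 A 0 1) (bU B)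
    (fun x _ x' _ h => add_le_add (clawS_mono hA h 0) (clawS_mono hA h 1)) (fun x _ x' _ h => clawU_mono hB h)
    (fun x _ x' _ h => clawS_add_pair hA h 0 1 h1) (fun x _ x' _ h => clawU_add_clawU_nonneg hB h)
  have t3 := sum_mul_nonneg_of_two hP hd hcor (fun x => clawS A x 4) (fun x => clawS B x 0 + clawS B x 1) (bS1 A 4) (bS2 B 0 1)
    (fun x _ x' _ h => clawS_mono hA h 4) (fun x _ x' _ h => add_le_add (clawS_mono hB h 0) (clawS_mono hB h 1))
    (fun x _ x' _ h => clawS_pair_self hA h 4 h4) (fun x _ x' _ h => clawS_add_pair hB h 0 1 h1)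
  have t4 := sum_mul_nonneg_of_two hP hd hcor (fun x => clawS A x 0 + clawS A x 1) (fun x => clawS B x 4) (bS2 A 0 1) (bS1 B 4)
    (fun x _ x' _ h => add_le_add (clawS_mono hA h 0) (clawS_mono hA h 1)) (fun x _ x' _ h => clawS_mono hB h 4)
    (fun x _ x' _ h => clawS_add_pair hA h 0 1 h1) (fun x _ x' _ h => clawS_pair_self hB h 4 h4)
  have t5 := sum_mul_nonneg_of_two hP hd hcor (fun x => clawPmin A p q r x + clawS A x 2) (fun x => clawPmax B p q r x + clawS B x 3)
    (bmS A 2) (bMS B 3)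
    (fun x _ x' _ h => add_le_add (clawPmin_mono hA h) (clawS_mono hA h 2)) (fun x _ x' _ h => add_le_add (clawPmax_mono hB h) (clawS_mono hB h 3))
    (fun x _ x' _ h => clawPmin_add_clawS_pair hA (p := p) (q := q) (r := r) h 2 h2')
    (fun x _ x' _ h => clawPmax_add_clawS_pair hB (p := p) (q := q) (r := r) h 3 h3')
  have t6 := sum_mul_nonneg_of_two hP hd hcor (fun x => clawPmax A p q r x + clawS A x 3) (fun x => clawPmin B p q r x + clawS B x 2)
    (bMS A 3) (bmS B 2)
    (fun x _ x' _ h => add_le_add (clawPmax_mono hA h) (clawS_mono hA h 3)) (fun x _ x' _ h => add_le_add (clawPmin_mono hB h) (clawS_mono hB h 2))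
    (fun x _ x' _ h => clawPmax_add_clawS_pair hA (p := p) (q := q) (r := r) h 3 h3')
    (fun x _ x' _ h => clawPmin_add_clawS_pair hB (p := p) (q := q) (r := r) h 2 h2')
  -- assemble
  have hKK := sum_le_sum step2
  rw [← mul_sum] at hKK
  simp only [sum_add_distrib] at hKK t1 t2 t3 t4 t5 t6 ⊢
  have hrow := sum_le_sum step1
  simp only [sum_add_distrib] at hrow
  linarith

end mainthm

/-! ### Corollaries -/

variable {β : Type} [DecidableEq β] [Fintype β]

/-- **`TriWIneq` for `P₁ ∧ clawPath p q r`** (`k = 5`) on every index cube, for every intersecting Kleitman shell `P₁`. [this work] -/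
theorem triW_nonneg_andProd_clawPath {p q r : Fin 5} (hpq : p ≠ q ∧ p ≠ r ∧ q ≠ r) {P₁ : Finset (Finset γ₁)}
    (hP : IsUpperSet (P₁ : Set (Finset γ₁))) (hd : Disjoint P₁ (refl P₁))
    (hcor : ∀ U V : Finset (Finset γ₁), IsUpperSet (U : Set (Finset γ₁)) → IsUpperSet (V : Set (Finset γ₁)) → 0 ≤ corP P₁ U V)
    (F G : Finset β → Finset (Finset (γ₁ ⊕ Fin 5)))
    (hF : ∀ x, IsUpperSet (F x : Set (Finset (γ₁ ⊕ Fin 5)))) (hG : ∀ x, IsUpperSet (G x : Set (Finset (γ₁ ⊕ Fin 5))))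
    (hFm : Monotone F) (hGm : Monotone G) :
    0 ≤ triW (andProd P₁ (clawPath p q r)) F G :=
  triW_nonneg_of_corP_nonneg (isUpperSet_andProd hP (isUpperSet_clawPath hpq))
    (fun _ _ hA hB => corP_andProd_clawPath_nonneg hP hd hcor hA hB hpq) F G hF hG hFm hGm

/-- **The AND-product with a claw-path block (`k = 5`) is again an intersecting Kleitman shell.** [this work] -/
theorem klShell_andProd_clawPath {p q r : Fin 5} (hpq : p ≠ q ∧ p ≠ r ∧ q ≠ r) {P₁ : Finset (Finset γ₁)}
    (hP : IsUpperSet (P₁ : Set (Finset γ₁))) (hd : Disjoint P₁ (refl P₁))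
    (hcor : ∀ U V : Finset (Finset γ₁), IsUpperSet (U : Set (Finset γ₁)) → IsUpperSet (V : Set (Finset γ₁)) → 0 ≤ corP P₁ U V) :
    KlShell (andProd P₁ (clawPath p q r) ∪ refl (andProd P₁ (clawPath p q r))) :=
  klShell_of_corP_nonneg (disjoint_andProd_refl hd _) fun _ _ hA hB => corP_andProd_clawPath_nonneg hP hd hcor hA hB hpq

/-- **`AndShellLower` for `Q = clawPath p q r`** (`k = 5`): the lower sandwich bound for `P₁ ∧ clawPath p q r`. [this work] -/
theorem lForm_le_scoreVal_andProd_clawPath {p q r : Fin 5} (hpq : p ≠ q ∧ p ≠ r ∧ q ≠ r) {P₁ : Finset (Finset γ₁)}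
    (hP : IsUpperSet (P₁ : Set (Finset γ₁))) (hd : Disjoint P₁ (refl P₁)) (hs : KlShell (P₁ ∪ refl P₁))
    {A B : Finset (Finset (γ₁ ⊕ Fin 5))} (hA : IsUpperSet (A : Set (Finset (γ₁ ⊕ Fin 5)))) (hB : IsUpperSet (B : Set (Finset (γ₁ ⊕ Fin 5)))) :
    lForm (andProd P₁ (clawPath p q r)) A B ≤ scoreVal (secFAScore P₁ (clawPath p q r)) A B :=
  lForm_le_scoreVal_secFAScore_of_corP_nonneg (disjoint_clawPath_refl (le_refl 5) hpq)
    (corP_andProd_clawPath_nonneg hP hd (fun U V hU hV => by rw [corP_eq_card_sub_card_of_disjoint hd]; exact hs U V hU hV) hA hB hpq)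

/-- Example: `maj3 ∧ clawPath p q r` (`n = 8`). [this work] -/
theorem corP_maj3_andProd_clawPath_nonneg {p q r : Fin 5} (hpq : p ≠ q ∧ p ≠ r ∧ q ≠ r) {A B : Finset (Finset (Fin 3 ⊕ Fin 5))}
    (hA : IsUpperSet (A : Set (Finset (Fin 3 ⊕ Fin 5)))) (hB : IsUpperSet (B : Set (Finset (Fin 3 ⊕ Fin 5)))) :
    0 ≤ corP (andProd maj3 (clawPath p q r)) A B :=
  corP_andProd_clawPath_nonneg isUpperSet_maj3 disjoint_maj3_refl (fun _ _ hU hV => corP_nonneg_of_selfDual maj3_selfDual hU hV) hA hB hpq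

/-- The block `clawPath 0 1 2` on `Fin 5` is `{234, 134} ∪ {4-sets} ∪ {⊤}` = `x₃x₄(x₁ ∨ x₂) ∨ (≥ 4 of 5)` (hex `fc808000`). [this work] -/
theorem clawPath_zero_one_two : clawPath (0 : Fin 5) 1 2
    = {{2, 3, 4}, {1, 3, 4}, {1, 2, 3, 4}, {0, 2, 3, 4}, {0, 1, 3, 4}, {0, 1, 2, 4}, {0, 1, 2, 3}, {0, 1, 2, 3, 4}} := by decide

/-- The indices `0 1 2 : Fin 5` are pairwise distinct (the hypothesis of the theorem for this block). [this work] -/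
theorem threeDistinct_clawPath : (0 : Fin 5) ≠ 1 ∧ (0 : Fin 5) ≠ 2 ∧ (1 : Fin 5) ≠ 2 := by decide

end FiveUpSet

end Summit.CriticalPhenomena.PercolationContinuityZ3.Theorems
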